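import Mathlib
import Summits.Ventures.HodgeRepro2.Tier7.Line3.AbsSummable
import Summits.Ventures.HodgeRepro2.T7SupportPoincareContinuity

/-!
# Tier 7 — LINE 3 support: the geometric (Poincaré-series) kernel `K_f(x, y) = Σ_γ f(x⁻¹ γ y)` from count and decay
(`Line3/PoincareKernel.lean`; t7-L1-p1, gen 2; Mathlib + p5's AbsSummable (p668020) + p1's PoincareContinuity (row 689, p672189))

Memo §2e (a) GEOMETRIC KERNEL (version (ii), the line of record): for the integrable archimedean test functions the
kernel `K_f(x, y) := Σ_{γ ∈ U(W_A)(F)} f(x⁻¹ γ y)` is an INFINITE sum; it «converges absolutely and uniformly on compacta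
(`f_fin` compactly supported; `f_{ι_j}` = the `D_k` coefficient with `‖a(g)‖⁻ᵏ` decay, `k ≥ 3`; lattice points of
`U(W_A)(F)` in a ball of radius `t` ≲ e^{2t₂ + 2t₃} — the same count × decay input as the dominant-term rows), so `K_f`
is continuous on `[G] × [G]`». Memo v10 §2f lists this as right-hand-column item (5): «the unfolding of `R(f)` to the
Poincaré-series kernel + its absolute convergence for the real `f`» — printed or small, not typed.

This file types the CONVERGENCE half as an abstract lemma with displayed hypotheses, on any topological group `G` with a
size function and any family `ι : Γ → G` of «lattice points»:
* `size_mul : ∀ x g y, size g ≤ size (x⁻¹ * g * y) + size x + size y` — two-sided translation moves the size by at most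
  the sizes of the translators. CAVEAT (crit-2 l. 15135, author's l. 15128): this ADDITIVE form is the property of a
  LOG-size (a distance: for the Cartan projection `g ↦ d(g·o, o)` it is the triangle inequality of the symmetric space),
  for which the lattice count is EXPONENTIAL, not polynomial — so §1–§2 below, true as stated, are NOT the package the
  memo's real objects satisfy; the memo's size is the archimedean invariant `κ ≍ e^{distance}`, whose translation property
  is MULTIPLICATIVE, and §3 carries the chain under that form (`hshift : 1 + size g ≤ M x * M y * (1 + size (x⁻¹ g y))`,
  `M` locally bounded; `Tier7/Line3/HyperbolicSize.lean` proves it for `cosh d(g·i, i)` on `SL(2, ℝ)`);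
* `hcount : #{γ : size (ι γ) ≤ R} ≤ C' (1 + R)^β` — the lattice count (x1 LatticeBoxCount / NumberFieldBoxCount, p5
  LatticeCount / NumberFieldHyperbolicCount at the model level);
* `hf : ‖f g‖ ≤ C (1 + size g)^(-α)` with `β < α` — the decay of the `D_k` coefficient (p1's T5Bergman rows).
CONCLUSIONS: the Poincaré series converges absolutely at every point (`summable_norm_shift`); on every size-bounded
set `{size ≤ c} × {size ≤ c}` all its terms have ONE summable majorant (`norm_le_majorant`, `summable_majorant`), so the
family is `LocallyDominated` in p1's sense as soon as the size is locally bounded (`locallyDominated_kernelSum`; e.g. for a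
continuous size, `size_locBdd_of_continuous`), and the kernel is continuous on `G × G` by p1's row 689
`continuous_tsum_of_locally_dominated` (`continuous_kernelSum`). The `Γ × Γ`-invariance of the kernel (descent to `[G] × [G]`) and its unfolding
`R(f)ψ(x) = ∫_{Γ\G} K_f(x, y) ψ(y) dy` are p1's row 690 `T7SupportUnfolding` and L1-p3's `Tier7/Line3/Unfolding.lean`
(U1/U1′/U3, l. 15093) — not re-declared here. The summability is p5's `summable_of_count_decay` with the finite
factor `b = 1` (so the dyadic slicing is not repeated here); the continuity glue is p1's (consumed by name, nothing
re-declared): this file supplies exactly the MAJORANT p1's docstring leaves to the line.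

Nothing about the real objects (`U(W_A)`, its rational points, the test functions) is typed (TYPING-CENSUS T7): that
the real Cartan size satisfies `size_mul`, that `U(W_A)(F)` has the polynomial count and that the real `f` has the decay
are the line's dictionary items, in words.
Sorry-free; axioms: propext / Classical.choice / Quot.sound. §8(d): uses an L-value-free non-vanishing device: NO.
-/

namespace Summit.Ventures.HodgeRepro2.Tier7.Line3.PoincareKernel

open Filter Topology

/-- the summable majorant `(1 + size γ)^(-α)` from the lattice count alone (p5's `summable_of_count_decay` with
`b = 1`, `d' = 0`). -/
theorem summable_rpow_neg_of_count {Γ : Type} (s : Γ → ℝ) (hs : ∀ γ, 0 ≤ s γ) {α β : ℝ} (hβ : 0 ≤ β)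
    (hαβ : β < α) {C' : ℝ} (hcount : ∀ R : ℝ, 0 ≤ R →
      ∃ t : Finset Γ, (∀ γ, s γ ≤ R → γ ∈ t) ∧ (t.card : ℝ) ≤ C' * (1 + R) ^ β) :
    Summable fun γ => (1 + s γ) ^ (-α) := by
  have h := AbsSummable.summable_of_count_decay (fun γ => ((1 + s γ) ^ (-α) : ℝ)) (fun _ => (1 : ℂ)) s hs
    (fun _ => True) (fun _ _ => trivial) hβ (d' := 0) (by linarith) (C := 1)
    (fun γ => by
      have h0 : 0 ≤ (1 + s γ) ^ (-α) := Real.rpow_nonneg (by linarith [hs γ]) _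
      rw [Complex.norm_real, Real.norm_eq_abs, abs_of_nonneg h0, one_mul])
    (C' := C') (fun R hR => by obtain ⟨t, ht⟩ := hcount R hR; exact ⟨t, fun γ _ hγ => ht.1 γ hγ, ht.2⟩)
    (Bb := 1) (fun γ _ => by simp)
  refine (h.congr fun γ => ?_).of_norm
  simp

variable {G : Type} [Group G] (size : G → ℝ)

/-- the size of a two-sided translate is at least the size minus the sizes of the translators: the form in which
`size_mul` is used. -/
theorem size_shift_le (size_mul : ∀ x g y, size g ≤ size (x⁻¹ * g * y) + size x + size y) (x g y : G) :
    size g - size x - size y ≤ size (x⁻¹ * g * y) := by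
  have := size_mul x g y; linarith

/-- the shifted majorant: for `size x, size y ≤ c`, `(1 + size (x⁻¹ g y))^(-α) ≤ (1 + 2c)^α (1 + size g)^(-α)`
(from `1 + size g ≤ (1 + 2c) (1 + size (x⁻¹ g y))`). -/
theorem rpow_neg_shift_le (size_nonneg : ∀ g, 0 ≤ size g)
    (size_mul : ∀ x g y, size g ≤ size (x⁻¹ * g * y) + size x + size y) {α : ℝ} (hα : 0 ≤ α)
    {c : ℝ} (hc : 0 ≤ c) {x y : G} (hx : size x ≤ c) (hy : size y ≤ c) (g : G) :
    (1 + size (x⁻¹ * g * y)) ^ (-α) ≤ (1 + 2 * c) ^ α * (1 + size g) ^ (-α) := by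
  have h1 : 0 ≤ 1 + size (x⁻¹ * g * y) := by linarith [size_nonneg (x⁻¹ * g * y)]
  have h2 : 0 < 1 + size g := by linarith [size_nonneg g]
  have h3 : 0 < 1 + size (x⁻¹ * g * y) := by linarith [size_nonneg (x⁻¹ * g * y)]
  have hkey : 1 + size g ≤ (1 + 2 * c) * (1 + size (x⁻¹ * g * y)) := by
    have := size_mul x g y
    nlinarith [size_nonneg (x⁻¹ * g * y), size_nonneg x, size_nonneg y]
  -- `(1 + size g)^(-α) ≥ ((1+2c)(1 + size (x⁻¹ g y)))^(-α) = (1+2c)^(-α) (1 + size(x⁻¹ g y))^(-α)`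
  have h4 : ((1 + 2 * c) * (1 + size (x⁻¹ * g * y))) ^ (-α) ≤ (1 + size g) ^ (-α) :=
    Real.rpow_le_rpow_of_nonpos h2 hkey (by linarith)
  rw [Real.mul_rpow (by linarith) h1] at h4
  have h5 : 0 < (1 + 2 * c) ^ α := Real.rpow_pos_of_pos (by linarith) α
  have h6 : (1 + 2 * c) ^ (-α) = ((1 + 2 * c) ^ α)⁻¹ := Real.rpow_neg (by linarith) α
  rw [h6] at h4
  calc (1 + size (x⁻¹ * g * y)) ^ (-α)
      = (1 + 2 * c) ^ α * (((1 + 2 * c) ^ α)⁻¹ * (1 + size (x⁻¹ * g * y)) ^ (-α)) := by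
        field_simp
    _ ≤ (1 + 2 * c) ^ α * (1 + size g) ^ (-α) := by
        exact mul_le_mul_of_nonneg_left h4 h5.le

variable {Γ : Type} (ι : Γ → G) (f : G → ℂ)

/-- **ABSOLUTE CONVERGENCE OF THE POINCARÉ SERIES AT EVERY POINT** from the count and the decay. -/
theorem summable_norm_shift (size_nonneg : ∀ g, 0 ≤ size g)
    (size_mul : ∀ x g y, size g ≤ size (x⁻¹ * g * y) + size x + size y) {α β : ℝ} (hβ : 0 ≤ β)
    (hαβ : β < α) {C' : ℝ} (hcount : ∀ R : ℝ, 0 ≤ R →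
      ∃ t : Finset Γ, (∀ γ, size (ι γ) ≤ R → γ ∈ t) ∧ (t.card : ℝ) ≤ C' * (1 + R) ^ β)
    {C : ℝ} (hf : ∀ g, ‖f g‖ ≤ C * (1 + size g) ^ (-α)) (x y : G) :
    Summable fun γ => ‖f (x⁻¹ * ι γ * y)‖ := by
  have hα : 0 ≤ α := by linarith
  set c : ℝ := max (size x) (size y) with hc
  have hc0 : 0 ≤ c := le_trans (size_nonneg x) (le_max_left _ _)
  have hsum : Summable fun γ => (1 + size (ι γ)) ^ (-α) :=
    summable_rpow_neg_of_count (fun γ => size (ι γ)) (fun γ => size_nonneg _) hβ hαβ hcount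
  refine Summable.of_nonneg_of_le (fun γ => norm_nonneg _) (fun γ => ?_)
    ((hsum.mul_left ((max C 0) * (1 + 2 * c) ^ α)))
  calc ‖f (x⁻¹ * ι γ * y)‖ ≤ C * (1 + size (x⁻¹ * ι γ * y)) ^ (-α) := hf _
    _ ≤ max C 0 * (1 + size (x⁻¹ * ι γ * y)) ^ (-α) :=
        mul_le_mul_of_nonneg_right (le_max_left _ _)
          (Real.rpow_nonneg (by linarith [size_nonneg (x⁻¹ * ι γ * y)]) _)
    _ ≤ max C 0 * ((1 + 2 * c) ^ α * (1 + size (ι γ)) ^ (-α)) :=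
        mul_le_mul_of_nonneg_left
          (rpow_neg_shift_le size size_nonneg size_mul hα hc0 (le_max_left _ _) (le_max_right _ _) (ι γ))
          (le_max_right _ _)
    _ = max C 0 * (1 + 2 * c) ^ α * (1 + size (ι γ)) ^ (-α) := by ring

/-- The Poincaré-series kernel `K_f(x, y) = Σ'_γ f(x⁻¹ γ y)` over the family `ι : Γ → G`; for a subgroup `Γ ≤ G` and
`ι = Subtype.val` this is p1's `T7SupportUnfolding.poincare Γ f x y` (row 690 target, l. 15091), which this file does not
re-declare (different carrier: an arbitrary family, not necessarily a subgroup). -/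
noncomputable def kernelSum (x y : G) : ℂ := ∑' γ, f (x⁻¹ * ι γ * y)

/-- the uniform majorant on a size-bounded set: for `size x, size y ≤ c`,
`‖f (x⁻¹ γ y)‖ ≤ max C 0 · (1 + 2c)^α · (1 + size γ)^(-α)`. -/
theorem norm_le_majorant (size_nonneg : ∀ g, 0 ≤ size g)
    (size_mul : ∀ x g y, size g ≤ size (x⁻¹ * g * y) + size x + size y) {α : ℝ} (hα : 0 ≤ α)
    {C : ℝ} (hf : ∀ g, ‖f g‖ ≤ C * (1 + size g) ^ (-α)) {c : ℝ} (hc : 0 ≤ c) {x y : G}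
    (hx : size x ≤ c) (hy : size y ≤ c) (g : G) :
    ‖f (x⁻¹ * g * y)‖ ≤ max C 0 * (1 + 2 * c) ^ α * (1 + size g) ^ (-α) :=
  calc ‖f (x⁻¹ * g * y)‖ ≤ C * (1 + size (x⁻¹ * g * y)) ^ (-α) := hf _
    _ ≤ max C 0 * (1 + size (x⁻¹ * g * y)) ^ (-α) :=
        mul_le_mul_of_nonneg_right (le_max_left _ _)
          (Real.rpow_nonneg (by linarith [size_nonneg (x⁻¹ * g * y)]) _)
    _ ≤ max C 0 * ((1 + 2 * c) ^ α * (1 + size g) ^ (-α)) :=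
        mul_le_mul_of_nonneg_left (rpow_neg_shift_le size size_nonneg size_mul hα hc hx hy g)
          (le_max_right _ _)
    _ = max C 0 * (1 + 2 * c) ^ α * (1 + size g) ^ (-α) := by ring

omit [Group G] in
/-- the majorant is summable over the lattice points (count alone). -/
theorem summable_majorant (size_nonneg : ∀ g, 0 ≤ size g) {α β : ℝ} (hβ : 0 ≤ β) (hαβ : β < α)
    {C' : ℝ} (hcount : ∀ R : ℝ, 0 ≤ R →
      ∃ t : Finset Γ, (∀ γ, size (ι γ) ≤ R → γ ∈ t) ∧ (t.card : ℝ) ≤ C' * (1 + R) ^ β) (K : ℝ) :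
    Summable fun γ => K * (1 + size (ι γ)) ^ (-α) :=
  (summable_rpow_neg_of_count (fun γ => size (ι γ)) (fun _ => size_nonneg _) hβ hαβ hcount).mul_left K

omit [Group G] in
/-- a continuous size is locally bounded. -/
theorem size_locBdd_of_continuous [TopologicalSpace G] (size_cont : Continuous size) (x₀ : G) :
    ∃ U ∈ 𝓝 x₀, ∃ c : ℝ, ∀ x ∈ U, size x ≤ c :=
  ⟨{x | size x < size x₀ + 1}, (isOpen_lt size_cont continuous_const).mem_nhds (by simp),
    size x₀ + 1, fun x hx => le_of_lt hx⟩

/-- **THE FAMILY `(x, y) ↦ f (x⁻¹ γ y)` IS LOCALLY DOMINATED** (p1's `LocallyDominated`, row 689) as soon as the size is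
locally bounded: near `(x₀, y₀)` take `c` bounding the size on neighbourhoods of `x₀` and `y₀`; the majorant is
`norm_le_majorant`, summable by `summable_majorant`. -/
theorem locallyDominated_kernelSum [TopologicalSpace G]
    (size_locBdd : ∀ x₀ : G, ∃ U ∈ 𝓝 x₀, ∃ c : ℝ, ∀ x ∈ U, size x ≤ c) (size_nonneg : ∀ g, 0 ≤ size g)
    (size_mul : ∀ x g y, size g ≤ size (x⁻¹ * g * y) + size x + size y) {α β : ℝ} (hβ : 0 ≤ β)
    (hαβ : β < α) {C' : ℝ} (hcount : ∀ R : ℝ, 0 ≤ R →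
      ∃ t : Finset Γ, (∀ γ, size (ι γ) ≤ R → γ ∈ t) ∧ (t.card : ℝ) ≤ C' * (1 + R) ^ β)
    {C : ℝ} (hf : ∀ g, ‖f g‖ ≤ C * (1 + size g) ^ (-α)) :
    T7SupportPoincareContinuity.LocallyDominated (fun γ (p : G × G) => f (p.1⁻¹ * ι γ * p.2)) := by
  have hα : 0 ≤ α := by linarith
  rintro ⟨x₀, y₀⟩
  obtain ⟨U, hU, c₁, hc₁⟩ := size_locBdd x₀
  obtain ⟨W, hW, c₂, hc₂⟩ := size_locBdd y₀
  set c : ℝ := max (max c₁ c₂) 0 with hc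
  have hc0 : 0 ≤ c := le_max_right _ _
  refine ⟨U ×ˢ W, prod_mem_nhds hU hW, fun γ => max C 0 * (1 + 2 * c) ^ α * (1 + size (ι γ)) ^ (-α),
    summable_majorant size ι size_nonneg hβ hαβ hcount _, fun γ p hp => ?_⟩
  exact norm_le_majorant size f size_nonneg size_mul hα hf hc0
    (le_trans (hc₁ p.1 hp.1) (le_trans (le_max_left c₁ c₂) (le_max_left _ _)))
    (le_trans (hc₂ p.2 hp.2) (le_trans (le_max_right c₁ c₂) (le_max_left _ _))) (ι γ)

/-- **CONTINUITY OF THE KERNEL** on `G × G` (p1's row 689 `continuous_tsum_of_locally_dominated` on the majorant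
above): `f` continuous, size locally bounded, count × decay with `β < α`. -/
theorem continuous_kernelSum [TopologicalSpace G] [IsTopologicalGroup G] (hfc : Continuous f)
    (size_locBdd : ∀ x₀ : G, ∃ U ∈ 𝓝 x₀, ∃ c : ℝ, ∀ x ∈ U, size x ≤ c) (size_nonneg : ∀ g, 0 ≤ size g)
    (size_mul : ∀ x g y, size g ≤ size (x⁻¹ * g * y) + size x + size y) {α β : ℝ} (hβ : 0 ≤ β)
    (hαβ : β < α) {C' : ℝ} (hcount : ∀ R : ℝ, 0 ≤ R →
      ∃ t : Finset Γ, (∀ γ, size (ι γ) ≤ R → γ ∈ t) ∧ (t.card : ℝ) ≤ C' * (1 + R) ^ β)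
    {C : ℝ} (hf : ∀ g, ‖f g‖ ≤ C * (1 + size g) ^ (-α)) :
    Continuous (fun p : G × G => kernelSum ι f p.1 p.2) :=
  T7SupportPoincareContinuity.continuous_tsum_of_locally_dominated
    (fun _ => hfc.comp ((continuous_fst.inv.mul continuous_const).mul continuous_snd))
    (locallyDominated_kernelSum size ι f size_locBdd size_nonneg size_mul hβ hαβ hcount hf)

/-- the same for a continuous size. -/
theorem continuous_kernelSum_of_continuous_size [TopologicalSpace G] [IsTopologicalGroup G] (hfc : Continuous f)
    (size_cont : Continuous size) (size_nonneg : ∀ g, 0 ≤ size g)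
    (size_mul : ∀ x g y, size g ≤ size (x⁻¹ * g * y) + size x + size y) {α β : ℝ} (hβ : 0 ≤ β)
    (hαβ : β < α) {C' : ℝ} (hcount : ∀ R : ℝ, 0 ≤ R →
      ∃ t : Finset Γ, (∀ γ, size (ι γ) ≤ R → γ ∈ t) ∧ (t.card : ℝ) ≤ C' * (1 + R) ^ β)
    {C : ℝ} (hf : ∀ g, ‖f g‖ ≤ C * (1 + size g) ^ (-α)) :
    Continuous (fun p : G × G => kernelSum ι f p.1 p.2) :=
  continuous_kernelSum size ι f hfc (size_locBdd_of_continuous size size_cont) size_nonneg size_mul hβ hαβ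
    hcount hf

/-! ## 3. The multiplicative form of the shift — the form the archimedean invariant `κ` satisfies

REFINEMENT (t7-L1-p1, after landing §1–§2): the additive `size_mul` above is the property of a LOG-size (a distance:
`d(x⁻¹ g y · o, o) ≥ d(g · o, o) − d(x · o, o) − d(y · o, o)`), for which the lattice count is EXPONENTIAL, not polynomial;
the memo's size is the archimedean invariant `κ ≍ e^{distance}` (p1's `KappaCartan.kappa_eq_normSq`, x1's
`KappaDefiniteBound`), whose translation property is MULTIPLICATIVE:
  `1 + κ(g) ≤ M x · M y · (1 + κ(x⁻¹ g y))` with `M` locally bounded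
(for the hyperbolic-cosine size `cosh d(g·i, i)` on `SL(2, ℝ)`: `M x = √8 · cosh d(x·i, i)`, Tier7/Line3/HyperbolicSize.lean).
Everything below is the chain of §2 under this form; the additive form is the special case `M x = 1 + size x`
(`shift_of_size_mul`). -/

/-- the additive form implies the multiplicative one with `M x = 1 + size x`. -/
theorem shift_of_size_mul (size_nonneg : ∀ g, 0 ≤ size g)
    (size_mul : ∀ x g y, size g ≤ size (x⁻¹ * g * y) + size x + size y) (x g y : G) :
    1 + size g ≤ (1 + size x) * (1 + size y) * (1 + size (x⁻¹ * g * y)) := by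
  have := size_mul x g y
  nlinarith [size_nonneg (x⁻¹ * g * y), size_nonneg x, size_nonneg y, mul_nonneg (size_nonneg x) (size_nonneg y),
    mul_nonneg (mul_nonneg (size_nonneg x) (size_nonneg y)) (size_nonneg (x⁻¹ * g * y)),
    mul_nonneg (size_nonneg x) (size_nonneg (x⁻¹ * g * y)), mul_nonneg (size_nonneg y) (size_nonneg (x⁻¹ * g * y))]

/-- the shifted majorant under the multiplicative shift: for `M x, M y ≤ c`,
`(1 + size (x⁻¹ g y))^(-α) ≤ (c · c)^α (1 + size g)^(-α)`. -/
theorem rpow_neg_shift_le_of_mul (size_nonneg : ∀ g, 0 ≤ size g) {M : G → ℝ} (hM : ∀ x, 0 ≤ M x)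
    (hshift : ∀ x g y, 1 + size g ≤ M x * M y * (1 + size (x⁻¹ * g * y))) {α : ℝ} (hα : 0 ≤ α)
    {c : ℝ} {x y : G} (hx : M x ≤ c) (hy : M y ≤ c) (g : G) :
    (1 + size (x⁻¹ * g * y)) ^ (-α) ≤ (c * c) ^ α * (1 + size g) ^ (-α) := by
  have h1 : 0 ≤ 1 + size (x⁻¹ * g * y) := by linarith [size_nonneg (x⁻¹ * g * y)]
  have h2 : 0 < 1 + size g := by linarith [size_nonneg g]
  have hc0 : 0 ≤ c := le_trans (hM x) hx
  have hkey : 1 + size g ≤ (c * c) * (1 + size (x⁻¹ * g * y)) := by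
    calc 1 + size g ≤ M x * M y * (1 + size (x⁻¹ * g * y)) := hshift x g y
      _ ≤ (c * c) * (1 + size (x⁻¹ * g * y)) := by
          apply mul_le_mul_of_nonneg_right _ h1
          exact mul_le_mul hx hy (hM y) hc0
  have hcc : 0 < c * c := by
    rcases lt_or_eq_of_le hc0 with h | h
    · positivity
    · exfalso; rw [← h] at hkey; simp at hkey; linarith
  have h4 : ((c * c) * (1 + size (x⁻¹ * g * y))) ^ (-α) ≤ (1 + size g) ^ (-α) :=
    Real.rpow_le_rpow_of_nonpos h2 hkey (by linarith)
  rw [Real.mul_rpow hcc.le h1] at h4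
  have h5 : 0 < (c * c) ^ α := Real.rpow_pos_of_pos hcc α
  have h6 : (c * c) ^ (-α) = ((c * c) ^ α)⁻¹ := Real.rpow_neg hcc.le α
  rw [h6] at h4
  calc (1 + size (x⁻¹ * g * y)) ^ (-α)
      = (c * c) ^ α * (((c * c) ^ α)⁻¹ * (1 + size (x⁻¹ * g * y)) ^ (-α)) := by
        rw [← mul_assoc, mul_inv_cancel₀ h5.ne', one_mul]
    _ ≤ (c * c) ^ α * (1 + size g) ^ (-α) := mul_le_mul_of_nonneg_left h4 h5.le

/-- the uniform majorant on `{M ≤ c} × {M ≤ c}` under the multiplicative shift. -/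
theorem norm_le_majorant_of_mul (size_nonneg : ∀ g, 0 ≤ size g) {M : G → ℝ} (hM : ∀ x, 0 ≤ M x)
    (hshift : ∀ x g y, 1 + size g ≤ M x * M y * (1 + size (x⁻¹ * g * y))) {α : ℝ} (hα : 0 ≤ α)
    {C : ℝ} (hf : ∀ g, ‖f g‖ ≤ C * (1 + size g) ^ (-α)) {c : ℝ} {x y : G}
    (hx : M x ≤ c) (hy : M y ≤ c) (g : G) :
    ‖f (x⁻¹ * g * y)‖ ≤ max C 0 * (c * c) ^ α * (1 + size g) ^ (-α) :=
  calc ‖f (x⁻¹ * g * y)‖ ≤ C * (1 + size (x⁻¹ * g * y)) ^ (-α) := hf _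
    _ ≤ max C 0 * (1 + size (x⁻¹ * g * y)) ^ (-α) :=
        mul_le_mul_of_nonneg_right (le_max_left _ _)
          (Real.rpow_nonneg (by linarith [size_nonneg (x⁻¹ * g * y)]) _)
    _ ≤ max C 0 * ((c * c) ^ α * (1 + size g) ^ (-α)) :=
        mul_le_mul_of_nonneg_left (rpow_neg_shift_le_of_mul size size_nonneg hM hshift hα hx hy g)
          (le_max_right _ _)
    _ = max C 0 * (c * c) ^ α * (1 + size g) ^ (-α) := by ring

/-- absolute convergence at every point under the multiplicative shift. -/
theorem summable_norm_shift_of_mul (size_nonneg : ∀ g, 0 ≤ size g) {M : G → ℝ} (hM : ∀ x, 0 ≤ M x)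
    (hshift : ∀ x g y, 1 + size g ≤ M x * M y * (1 + size (x⁻¹ * g * y))) {α β : ℝ} (hβ : 0 ≤ β)
    (hαβ : β < α) {C' : ℝ} (hcount : ∀ R : ℝ, 0 ≤ R →
      ∃ t : Finset Γ, (∀ γ, size (ι γ) ≤ R → γ ∈ t) ∧ (t.card : ℝ) ≤ C' * (1 + R) ^ β)
    {C : ℝ} (hf : ∀ g, ‖f g‖ ≤ C * (1 + size g) ^ (-α)) (x y : G) :
    Summable fun γ => ‖f (x⁻¹ * ι γ * y)‖ := by
  have hα : 0 ≤ α := by linarith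
  set c : ℝ := max (M x) (M y) with hc
  refine Summable.of_nonneg_of_le (fun γ => norm_nonneg _) (fun γ => ?_)
    (summable_majorant size ι size_nonneg hβ hαβ hcount (max C 0 * (c * c) ^ α))
  exact norm_le_majorant_of_mul size f size_nonneg hM hshift hα hf (le_max_left _ _) (le_max_right _ _) (ι γ)

/-- **THE FAMILY IS LOCALLY DOMINATED under the multiplicative shift** as soon as `M` is locally bounded. -/
theorem locallyDominated_kernelSum_of_mul [TopologicalSpace G] {M : G → ℝ} (hM : ∀ x, 0 ≤ M x)
    (M_locBdd : ∀ x₀ : G, ∃ U ∈ 𝓝 x₀, ∃ c : ℝ, ∀ x ∈ U, M x ≤ c) (size_nonneg : ∀ g, 0 ≤ size g)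
    (hshift : ∀ x g y, 1 + size g ≤ M x * M y * (1 + size (x⁻¹ * g * y))) {α β : ℝ} (hβ : 0 ≤ β)
    (hαβ : β < α) {C' : ℝ} (hcount : ∀ R : ℝ, 0 ≤ R →
      ∃ t : Finset Γ, (∀ γ, size (ι γ) ≤ R → γ ∈ t) ∧ (t.card : ℝ) ≤ C' * (1 + R) ^ β)
    {C : ℝ} (hf : ∀ g, ‖f g‖ ≤ C * (1 + size g) ^ (-α)) :
    T7SupportPoincareContinuity.LocallyDominated (fun γ (p : G × G) => f (p.1⁻¹ * ι γ * p.2)) := by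
  have hα : 0 ≤ α := by linarith
  rintro ⟨x₀, y₀⟩
  obtain ⟨U, hU, c₁, hc₁⟩ := M_locBdd x₀
  obtain ⟨W, hW, c₂, hc₂⟩ := M_locBdd y₀
  set c : ℝ := max c₁ c₂ with hc
  refine ⟨U ×ˢ W, prod_mem_nhds hU hW, fun γ => max C 0 * (c * c) ^ α * (1 + size (ι γ)) ^ (-α),
    summable_majorant size ι size_nonneg hβ hαβ hcount _, fun γ p hp => ?_⟩
  exact norm_le_majorant_of_mul size f size_nonneg hM hshift hα hf
    (le_trans (hc₁ p.1 hp.1) (le_max_left c₁ c₂)) (le_trans (hc₂ p.2 hp.2) (le_max_right c₁ c₂)) (ι γ)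

/-- **CONTINUITY OF THE KERNEL under the multiplicative shift** (p1's row 689 on the majorant above). -/
theorem continuous_kernelSum_of_mul [TopologicalSpace G] [IsTopologicalGroup G] (hfc : Continuous f)
    {M : G → ℝ} (hM : ∀ x, 0 ≤ M x) (M_locBdd : ∀ x₀ : G, ∃ U ∈ 𝓝 x₀, ∃ c : ℝ, ∀ x ∈ U, M x ≤ c)
    (size_nonneg : ∀ g, 0 ≤ size g)
    (hshift : ∀ x g y, 1 + size g ≤ M x * M y * (1 + size (x⁻¹ * g * y))) {α β : ℝ} (hβ : 0 ≤ β)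
    (hαβ : β < α) {C' : ℝ} (hcount : ∀ R : ℝ, 0 ≤ R →
      ∃ t : Finset Γ, (∀ γ, size (ι γ) ≤ R → γ ∈ t) ∧ (t.card : ℝ) ≤ C' * (1 + R) ^ β)
    {C : ℝ} (hf : ∀ g, ‖f g‖ ≤ C * (1 + size g) ^ (-α)) :
    Continuous (fun p : G × G => kernelSum ι f p.1 p.2) :=
  T7SupportPoincareContinuity.continuous_tsum_of_locally_dominated
    (fun _ => hfc.comp ((continuous_fst.inv.mul continuous_const).mul continuous_snd))
    (locallyDominated_kernelSum_of_mul size ι f hM M_locBdd size_nonneg hshift hβ hαβ hcount hf)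

end Summit.Ventures.HodgeRepro2.Tier7.Line3.PoincareKernel
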